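import Mathlib
import HarnessLib

/-!
# The two mod-`8` normal-form lemmas of es's STEP 3: `u² + p w² = 2m²` (`p ≡ 3 (4)`) and `b² = 2a² + c²`
(route `ManinLocalTwoThree`, crux C2 `ManinOddAtFour` stmt-BirchSwinnertonDyer-22967; cell bsd-f2-manin, prover p2 gen 21; nodes for the Lean proof of E-es-185
`IndexFourForcesFreyTwistShape`, es g38 PROOF-Ees185-186.md §5 «Normalisation» / MEMO-es §59.13(b); `--supports stmt-BirchSwinnertonDyer-22967`)

In es's EXCLUSION THEOREM the Frey-twist shape `y² = x(x − t²)(x − 2s²)`, `t` odd, `s` even, is reached from the 2-descent sign table through two ternary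
quadratic equations and their mod-`8` analysis (PROOF-Ees185-186.md §5, verbatim): case (ii) `u² + p w² = 2m²` with `p ≡ 3 (mod 4)` and `(u, w, m)` primitive
forces `m` EVEN and `u, w` ODD; case (iii-h₁) `b² = 2a² + c²` primitive forces `a` EVEN and `b, c` ODD.  This file proves both by reduction to `ZMod 8` and
`decide`:

* `even_and_odd_of_sq_add_mul_sq_eq_two_mul_sq` — `p % 4 = 3`, `u² + p·w² = 2·m²`, not both `u, w` even ⟹ `Even m ∧ Odd u ∧ Odd w`;
* `even_and_odd_of_sq_eq_two_mul_sq_add_sq` — `b² = 2·a² + c²`, not both `b, c` even ⟹ `Even a ∧ Odd b ∧ Odd c`.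

(«Primitive» enters only as «not all even»: if `u, w` are even so is `m`, resp. if `b, c` are even so is `a`.)  UNCONDITIONAL elementary number theory;
nothing about C2, Manin's conjecture or BSD is proved by this.  No definitions, no sorry. [folklore]
-/

set_option autoImplicit false
-- lint-debt: the directory name repeats the summit name (sibling precedent `ManinLocalTwoThreeTwoTorsionLegendreNormalForm.lean`)
set_option linter.dupNamespace false

namespace Summit.BirchSwinnertonDyer.BirchSwinnertonDyer.Theorems.ManinLocalTwoThree.FreyTwistParity

/-! ## §1 Parity read in `ZMod 8` -/

/-- An even integer reduces mod `8` to one of `0, 2, 4, 6`. [folklore] -/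
theorem cast_zmod_eight_of_two_dvd {m : ℤ} (h : 2 ∣ m) :
    (m : ZMod 8) = 0 ∨ (m : ZMod 8) = 2 ∨ (m : ZMod 8) = 4 ∨ (m : ZMod 8) = 6 := by
  obtain ⟨k, rfl⟩ := h
  push_cast
  generalize (k : ZMod 8) = K
  revert K
  decide

/-- An odd integer reduces mod `8` to one of `1, 3, 5, 7`. [folklore] -/
theorem cast_zmod_eight_of_not_two_dvd {m : ℤ} (h : ¬ 2 ∣ m) :
    (m : ZMod 8) = 1 ∨ (m : ZMod 8) = 3 ∨ (m : ZMod 8) = 5 ∨ (m : ZMod 8) = 7 := by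
  have hodd : Odd m := Int.not_even_iff_odd.mp (fun he ↦ h (even_iff_two_dvd.mp he))
  obtain ⟨k, rfl⟩ := hodd
  push_cast
  generalize (k : ZMod 8) = K
  revert K
  decide

/-- Conversely, a residue `0, 2, 4, 6` mod `8` means the integer is even. [folklore] -/
theorem two_dvd_of_cast_zmod_eight {m : ℤ}
    (h : (m : ZMod 8) = 0 ∨ (m : ZMod 8) = 2 ∨ (m : ZMod 8) = 4 ∨ (m : ZMod 8) = 6) : 2 ∣ m := by
  by_contra hodd
  rcases cast_zmod_eight_of_not_two_dvd hodd with h' | h' | h' | h' <;> rw [h'] at h <;> revert h <;> decide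

/-- `p % 4 = 3` ⟹ `p ≡ 3` or `7 (mod 8)`. [folklore] -/
theorem cast_zmod_eight_of_mod_four_eq_three {p : ℕ} (hp : p % 4 = 3) : (p : ZMod 8) = 3 ∨ (p : ZMod 8) = 7 := by
  have h8 : p % 8 = 3 ∨ p % 8 = 7 := by omega
  rw [← ZMod.natCast_mod p 8]
  rcases h8 with h | h <;> rw [h] <;> decide

/-! ## §2 `u² + p w² = 2m²`, `p ≡ 3 (mod 4)` -/

/-- The mod-`8` table for `U² + P W² = 2M²`, `P ∈ {3, 7}`: unless `U, W` are both even, `M` is even and `U, W` are odd. [folklore] -/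
theorem zmod_eight_table_one : ∀ U W M : ZMod 8,
    (U ^ 2 + 3 * W ^ 2 = 2 * M ^ 2 ∨ U ^ 2 + 7 * W ^ 2 = 2 * M ^ 2) →
    ¬ ((U = 0 ∨ U = 2 ∨ U = 4 ∨ U = 6) ∧ (W = 0 ∨ W = 2 ∨ W = 4 ∨ W = 6)) →
    (M = 0 ∨ M = 2 ∨ M = 4 ∨ M = 6) ∧ ¬ (U = 0 ∨ U = 2 ∨ U = 4 ∨ U = 6) ∧ ¬ (W = 0 ∨ W = 2 ∨ W = 4 ∨ W = 6) := by
  decide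

/-- **es's case (ii) normal form**: for a prime `p ≡ 3 (mod 4)` (only `p % 4 = 3` is used) and integers with `u² + p·w² = 2·m²`, not both `u, w` even,
one has `m` even and `u, w` odd (so `y² = x(x − u²)(x − 2m²)` has the Frey-twist shape `t = u` odd, `s = m` even). [folklore] -/
theorem even_and_odd_of_sq_add_mul_sq_eq_two_mul_sq {p : ℕ} (hp : p % 4 = 3) {u w m : ℤ}
    (h : u ^ 2 + (p : ℤ) * w ^ 2 = 2 * m ^ 2) (hprim : ¬ (2 ∣ u ∧ 2 ∣ w)) : Even m ∧ Odd u ∧ Odd w := by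
  have h8 : (u : ZMod 8) ^ 2 + (p : ZMod 8) * (w : ZMod 8) ^ 2 = 2 * (m : ZMod 8) ^ 2 := by exact_mod_cast congrArg (Int.cast : ℤ → ZMod 8) h
  have heq : (u : ZMod 8) ^ 2 + 3 * (w : ZMod 8) ^ 2 = 2 * (m : ZMod 8) ^ 2 ∨
      (u : ZMod 8) ^ 2 + 7 * (w : ZMod 8) ^ 2 = 2 * (m : ZMod 8) ^ 2 := by
    rcases cast_zmod_eight_of_mod_four_eq_three hp with hp' | hp' <;> rw [hp'] at h8
    · exact Or.inl h8
    · exact Or.inr h8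
  have hne : ¬ (((u : ZMod 8) = 0 ∨ (u : ZMod 8) = 2 ∨ (u : ZMod 8) = 4 ∨ (u : ZMod 8) = 6) ∧
      ((w : ZMod 8) = 0 ∨ (w : ZMod 8) = 2 ∨ (w : ZMod 8) = 4 ∨ (w : ZMod 8) = 6)) :=
    fun hh ↦ hprim ⟨two_dvd_of_cast_zmod_eight hh.1, two_dvd_of_cast_zmod_eight hh.2⟩
  obtain ⟨hM, hU, hW⟩ := zmod_eight_table_one _ _ _ heq hne
  refine ⟨even_iff_two_dvd.mpr (two_dvd_of_cast_zmod_eight hM), ?_, ?_⟩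
  · exact Int.not_even_iff_odd.mp fun he ↦ hU (cast_zmod_eight_of_two_dvd (even_iff_two_dvd.mp he))
  · exact Int.not_even_iff_odd.mp fun he ↦ hW (cast_zmod_eight_of_two_dvd (even_iff_two_dvd.mp he))

/-! ## §3 `b² = 2a² + c²` -/

/-- The mod-`8` table for `B² = 2A² + C²`: unless `B, C` are both even, `A` is even and `B, C` are odd. [folklore] -/
theorem zmod_eight_table_two : ∀ A B C : ZMod 8, B ^ 2 = 2 * A ^ 2 + C ^ 2 →
    ¬ ((B = 0 ∨ B = 2 ∨ B = 4 ∨ B = 6) ∧ (C = 0 ∨ C = 2 ∨ C = 4 ∨ C = 6)) →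
    (A = 0 ∨ A = 2 ∨ A = 4 ∨ A = 6) ∧ ¬ (B = 0 ∨ B = 2 ∨ B = 4 ∨ B = 6) ∧ ¬ (C = 0 ∨ C = 2 ∨ C = 4 ∨ C = 6) := by
  decide

/-- **es's case (iii-h₁) normal form**: integers with `b² = 2·a² + c²`, not both `b, c` even, have `a` even and `b, c` odd (so `y² = x(x − 2a²)(x − b²)` has
the Frey-twist shape `s = a` even, `t = b` odd). [folklore] -/
theorem even_and_odd_of_sq_eq_two_mul_sq_add_sq {a b c : ℤ} (h : b ^ 2 = 2 * a ^ 2 + c ^ 2) (hprim : ¬ (2 ∣ b ∧ 2 ∣ c)) :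
    Even a ∧ Odd b ∧ Odd c := by
  have h8 : (b : ZMod 8) ^ 2 = 2 * (a : ZMod 8) ^ 2 + (c : ZMod 8) ^ 2 := by exact_mod_cast congrArg (Int.cast : ℤ → ZMod 8) h
  have hne : ¬ (((b : ZMod 8) = 0 ∨ (b : ZMod 8) = 2 ∨ (b : ZMod 8) = 4 ∨ (b : ZMod 8) = 6) ∧
      ((c : ZMod 8) = 0 ∨ (c : ZMod 8) = 2 ∨ (c : ZMod 8) = 4 ∨ (c : ZMod 8) = 6)) :=
    fun hh ↦ hprim ⟨two_dvd_of_cast_zmod_eight hh.1, two_dvd_of_cast_zmod_eight hh.2⟩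
  obtain ⟨hA, hB, hC⟩ := zmod_eight_table_two _ _ _ h8 hne
  refine ⟨even_iff_two_dvd.mpr (two_dvd_of_cast_zmod_eight hA), ?_, ?_⟩
  · exact Int.not_even_iff_odd.mp fun he ↦ hB (cast_zmod_eight_of_two_dvd (even_iff_two_dvd.mp he))
  · exact Int.not_even_iff_odd.mp fun he ↦ hC (cast_zmod_eight_of_two_dvd (even_iff_two_dvd.mp he))

end Summit.BirchSwinnertonDyer.BirchSwinnertonDyer.Theorems.ManinLocalTwoThree.FreyTwistParity
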